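import Mathlib
import HarnessLib
import Literature.MathematicalPhysics.StatisticalMechanics.TorusFRDGradCovLipschitz

/-!
# Second differences of `∇^θ𝒞_{A,k}(x)` (hence of `γ_p(𝒞_{1+q,k})`) ALONG LINES of coefficient matrices,
# from clause (iv) of `TorusFRD` with `ℓ = 2` (the kernel input of the `ℓ = 2` q-slots of [ABKM19] Lemma 12.6)

`TorusFRDGradCovLipschitz` integrates the FIRST `A`-derivative bound of the finite-range decomposition along
a segment (mean value).  Here the SECOND derivative bound (`ℓ = 2` in clause (iv)) is integrated twice:

* `abs_line_secondDiff_le` — real analysis: `|f(2t) − 2f(t) + f(0)| ≤ D t²` when `|f''| ≤ D` on `[0,2t]`;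
* `abs_iterDiff_segment_secondDiff_le` — for a kernel family `A ↦ 𝒦_A`, smooth along the segment
  `A₀ + sB`, `s ∈ [0,2t]` (an open interval of smoothness around every point, as in clause (iv)) with
  `|∂²_s ∇^θ𝒦_{A₀+uB+sB}(x)|_{s=0}| ≤ D`:  `|∇^θ𝒦_{A₀+2tB}(x) − 2∇^θ𝒦_{A₀+tB}(x) + ∇^θ𝒦_{A₀}(x)| ≤ D t²`;
* **`abs_gradCov_line_secondDiff_le_of_torusFRD`** — for the torus package, `B` unit symmetric, an
  elliptic segment `A₀ + sB`, `s ∈ [0,2t]`, `1 ≤ k ≤ N+1`, `n ≥ 2`: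
  `L^{(k−1)d}·|γ_p(𝒞_{A₀+2tB,k}) − 2γ_p(𝒞_{A₀+tB,k}) + γ_p(𝒞_{A₀,k})| ≤ secondDiffConst(α ↦ C_{α,2}) · t²`.

Together with `ParallelogramSecondDiff.norm_secondDiff_le_bilinear` this gives the bilinear parallelogram
second differences of `γ_p(𝒞_{1+q,k})` in `q`, i.e. (with `A_k⁻¹` affine in `γ`) the family (F4a2).
Everything is proved; no named fact.

## References
* S. Adams, S. Buchholz, R. Kotecký, S. Müller, arXiv:1910.13564, Theorem 6.1 (iv), Lemma 10.5, Lemma 12.6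
  [AdamsBuchholzKoteckyMuller2019].
* S. Buchholz, J. Funct. Anal. 275 (2018), Thm 2.4 [Buchholz2016].
-/

noncomputable section

namespace Literature.MathematicalPhysics.StatisticalMechanics.GradientRG

open Real Set Finset
open Literature.MathematicalPhysics.StatisticalMechanics.GradientFRD
  (fourierCoeff IsElliptic IsUnitSymm iterDiff)

variable {d M : ℕ} [NeZero M]

/-! ## Real analysis: second differences along a line -/

omit [NeZero M] in
/-- `|f(2t) − 2f(t) + f(0)| ≤ D t²` if `f` is differentiable on `[0,2t]` with derivative `f'`, `f'` is
differentiable there with derivative `f''`, and `|f''| ≤ D`. [cite: AdamsBuchholzKoteckyMuller2019, Lemma 12.6 (12.51)] -/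
theorem abs_line_secondDiff_le {f f' f'' : ℝ → ℝ} {t D : ℝ} (ht : 0 ≤ t)
    (hf : ∀ u ∈ Icc 0 (2 * t), HasDerivAt f (f' u) u) (hf' : ∀ u ∈ Icc 0 (2 * t), HasDerivAt f' (f'' u) u)
    (hbound : ∀ u ∈ Icc 0 (2 * t), |f'' u| ≤ D) :
    |f (2 * t) - 2 * f t + f 0| ≤ D * t ^ 2 := by
  have hD : 0 ≤ D := by
    have := hbound 0 ⟨le_rfl, by linarith⟩; exact (abs_nonneg _).trans this
  -- the derivative is `D t`-Lipschitz over a step `t` inside `[0, 2t]`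
  have hstep : ∀ u ∈ Icc 0 t, |f' (u + t) - f' u| ≤ D * t := by
    intro u hu
    have hderivW : ∀ v ∈ Icc u (u + t), HasDerivWithinAt f' (f'' v) (Icc u (u + t)) v :=
      fun v hv => (hf' v ⟨hu.1.trans hv.1, by linarith [hv.2, hu.2]⟩).hasDerivWithinAt
    have hboundW : ∀ v ∈ Ico u (u + t), ‖f'' v‖ ≤ D := fun v hv => by
      rw [Real.norm_eq_abs]; exact hbound v ⟨hu.1.trans hv.1, by linarith [hv.2, hu.2]⟩
    have h := norm_image_sub_le_of_norm_deriv_le_segment' hderivW hboundW (u + t) (right_mem_Icc.2 (by linarith))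
    rw [Real.norm_eq_abs, add_sub_cancel_left] at h
    exact h
  -- `g(u) = f(u+t) − f(u)` on `[0, t]`
  set g : ℝ → ℝ := fun u => f (u + t) - f u with hg
  have hgderiv : ∀ u ∈ Icc 0 t, HasDerivWithinAt g (f' (u + t) - f' u) (Icc 0 t) u := by
    intro u hu
    have h1 : HasDerivAt (fun u => f (u + t)) (f' (u + t)) u := by
      have := hf (u + t) ⟨by linarith [hu.1], by linarith [hu.2]⟩
      exact this.comp_add_const u t
    have h2 : HasDerivAt f (f' u) u := hf u ⟨hu.1, by linarith [hu.2]⟩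
    exact (h1.sub h2).hasDerivWithinAt
  have hgbound : ∀ u ∈ Ico 0 t, ‖f' (u + t) - f' u‖ ≤ D * t := fun u hu => by
    rw [Real.norm_eq_abs]; exact hstep u (Ico_subset_Icc_self hu)
  have h := norm_image_sub_le_of_norm_deriv_le_segment' hgderiv hgbound t (right_mem_Icc.2 ht)
  rw [Real.norm_eq_abs, sub_zero] at h
  have e : g t - g 0 = f (2 * t) - 2 * f t + f 0 := by
    simp only [hg, zero_add]; ring_nf
  rw [e] at h
  calc |f (2 * t) - 2 * f t + f 0| ≤ D * t * t := h
    _ = D * t ^ 2 := by ring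

/-! ## Second differences of `∇^θ𝒦` along a segment of coefficient matrices -/

/-- **Second-order mean-value step along a segment**: if for every `u ∈ [0,2t]` the real-space values
`s ↦ 𝒦_{A₀+uB+sB}(y)` are smooth on an open interval around `0` (all `y`) and
`|∂²_s ∇^θ𝒦_{A₀+uB+sB}(x)|_{s=0}| ≤ D`, then
`|∇^θ𝒦_{A₀+2tB}(x) − 2∇^θ𝒦_{A₀+tB}(x) + ∇^θ𝒦_{A₀}(x)| ≤ D t²`.
[cite: AdamsBuchholzKoteckyMuller2019, Theorem 6.1 (iv)] -/
theorem abs_iterDiff_segment_secondDiff_le {𝒦 : Matrix (Fin d) (Fin d) ℝ → (Fin d → ZMod M) → ℝ}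
    {A₀ B : Matrix (Fin d) (Fin d) ℝ} {t D : ℝ} (ht : 0 ≤ t) (θ : Fin d → ℕ) (x : Fin d → ZMod M)
    (hsmooth : ∀ u ∈ Icc 0 (2 * t), ∃ ε : ℝ, 0 < ε ∧ ∀ y,
      ContDiffOn ℝ ⊤ (fun s : ℝ => 𝒦 (A₀ + u • B + s • B) y) (Ioo (-ε) ε))
    (hbound : ∀ u ∈ Icc 0 (2 * t),
      |iteratedDeriv 2 (fun s : ℝ => iterDiff θ (𝒦 (A₀ + u • B + s • B)) x) 0| ≤ D) :
    |iterDiff θ (𝒦 (A₀ + (2 * t) • B)) x - 2 * iterDiff θ (𝒦 (A₀ + t • B)) x + iterDiff θ (𝒦 A₀) x| ≤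
      D * t ^ 2 := by
  set Φ := iterDiffLM (M := M) θ x with hΦ
  set f : ℝ → ℝ := fun u => iterDiff θ (𝒦 (A₀ + u • B)) x with hf
  -- `f` is smooth on an open neighbourhood of every point of `[0, 2t]`
  have hloc : ∀ u ∈ Icc 0 (2 * t), ∃ ε : ℝ, 0 < ε ∧ ContDiffOn ℝ ⊤ f (Ioo (u - ε) (u + ε)) := by
    intro u hu
    obtain ⟨ε, hε, hcd⟩ := hsmooth u hu
    refine ⟨ε, hε, ?_⟩
    set F : ℝ → ℝ := fun s => iterDiff θ (𝒦 (A₀ + u • B + s • B)) x with hF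
    have hG : ContDiffOn ℝ ⊤ (fun s : ℝ => (fun y => 𝒦 (A₀ + u • B + s • B) y)) (Ioo (-ε) ε) :=
      contDiffOn_pi.2 fun y => hcd y
    have hFcd : ContDiffOn ℝ ⊤ F (Ioo (-ε) ε) := by
      have : F = fun s => Φ.toContinuousLinearMap (fun y => 𝒦 (A₀ + u • B + s • B) y) := by
        funext s; simp [hF, hΦ, iterDiffLM]
      rw [this]
      exact Φ.toContinuousLinearMap.contDiff.comp_contDiffOn hG
    have hfF : ∀ v, f v = F (v - u) := by
      intro v; simp only [hf, hF]; congr 2; rw [add_assoc, ← add_smul, add_sub_cancel]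
    have hfeq : f = F ∘ fun v => v - u := funext fun v => hfF v
    rw [hfeq]
    refine hFcd.comp (contDiffOn_id.sub contDiffOn_const) fun v hv => ?_
    simp only [Set.mem_Ioo] at hv ⊢
    constructor <;> linarith [hv.1, hv.2]
  -- derivatives of `f` on `[0, 2t]`
  have hderiv : ∀ u ∈ Icc 0 (2 * t), HasDerivAt f (deriv f u) u ∧ HasDerivAt (deriv f) (deriv (deriv f) u) u := by
    intro u hu
    obtain ⟨ε, hε, hcd⟩ := hloc u hu
    have hopen : IsOpen (Ioo (u - ε) (u + ε)) := isOpen_Ioo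
    have hmem : Ioo (u - ε) (u + ε) ∈ nhds u := hopen.mem_nhds ⟨by linarith, by linarith⟩
    have h1 : DifferentiableAt ℝ f u := (hcd.differentiableOn (by simp)).differentiableAt hmem
    have hcd' : ContDiffOn ℝ ⊤ (deriv f) (Ioo (u - ε) (u + ε)) :=
      hcd.deriv_of_isOpen hopen (by simp)
    have h2 : DifferentiableAt ℝ (deriv f) u := (hcd'.differentiableOn (by simp)).differentiableAt hmem
    exact ⟨h1.hasDerivAt, h2.hasDerivAt⟩
  -- the second derivative of `f` at `u` is the rebased `iteratedDeriv 2` at `0`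
  have hsecond : ∀ u, deriv (deriv f) u = iteratedDeriv 2 (fun s : ℝ => iterDiff θ (𝒦 (A₀ + u • B + s • B)) x) 0 := by
    intro u
    have hF : (fun s : ℝ => iterDiff θ (𝒦 (A₀ + u • B + s • B)) x) = fun s => f (s + u) := by
      funext s; simp only [hf]; congr 2; rw [add_assoc, ← add_smul, add_comm u s]
    rw [hF, iteratedDeriv_succ, iteratedDeriv_one]
    have hd1 : deriv (fun s => f (s + u)) = fun s => deriv f (s + u) := by
      funext s; exact deriv_comp_add_const f u s
    rw [hd1, deriv_comp_add_const (deriv f) u 0, zero_add]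
  have hbound' : ∀ u ∈ Icc 0 (2 * t), |deriv (deriv f) u| ≤ D := fun u hu => by
    rw [hsecond u]; exact hbound u hu
  have h := abs_line_secondDiff_le (f := f) (f' := deriv f) (f'' := deriv (deriv f)) ht
    (fun u hu => (hderiv u hu).1) (fun u hu => (hderiv u hu).2) hbound'
  have h0 : f 0 = iterDiff θ (𝒦 A₀) x := by simp [hf]
  simpa [hf, h0] using h

/-! ## The package: line second differences of `γ_p` -/

/-- **Second differences of `γ_p(𝒞_{A,k})` along an elliptic segment of coefficient matrices** (clause (iv)
of `TorusFRD d`, `ℓ = 2`, `|α| = 2`): for `B` unit symmetric, `t ≥ 0`, the segment `A₀ + sB`, `s ∈ [0,2t]`,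
in `𝓛(½,2)`, `1 ≤ k ≤ N+1`, `n ≥ 2`, and every quadratic index `p`,
`L^{(k−1)d}·|γ_p(𝒞_{A₀+2tB,k}) − 2γ_p(𝒞_{A₀+tB,k}) + γ_p(𝒞_{A₀,k})| ≤ secondDiffConst(α ↦ C_{α,2}) · t²`.
[cite: AdamsBuchholzKoteckyMuller2019, Theorem 6.1 (iv) / Lemma 12.6] -/
theorem abs_gradCov_line_secondDiff_le_of_torusFRD
    {𝒞 : Matrix (Fin d) (Fin d) ℝ → ℕ → (Fin d → ZMod M) → ℝ} {Cα : (Fin d → ℕ) → ℕ → ℝ} {L N n : ℕ}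
    (hiv : ∀ A : Matrix (Fin d) (Fin d) ℝ, IsElliptic (1 / 2 : ℝ) 2 A →
      ∀ k, 1 ≤ k → k ≤ N + 1 → ∀ B : Matrix (Fin d) (Fin d) ℝ, IsUnitSymm B →
        (∃ ε : ℝ, 0 < ε ∧ ∀ x : Fin d → ZMod M,
          ContDiffOn ℝ ⊤ (fun s : ℝ => 𝒞 (A + s • B) k x) (Set.Ioo (-ε) ε)) ∧
        ∀ α : Fin d → ℕ, ∑ i, α i ≤ n → ∀ ℓ : ℕ, ∀ x : Fin d → ZMod M,
          abs (iteratedDeriv ℓ (fun s : ℝ => iterDiff α (𝒞 (A + s • B) k) x) 0)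
            ≤ Cα α ℓ / (L : ℝ) ^ ((k - 1) * (d - 2 + ∑ i, α i)))
    (hd : 2 ≤ d) (hn : 2 ≤ n) (hL : 1 ≤ L)
    {A₀ B : Matrix (Fin d) (Fin d) ℝ} (hBu : IsUnitSymm B) {t : ℝ} (ht : 0 ≤ t)
    (hell : ∀ s ∈ Icc 0 (2 * t), IsElliptic (1 / 2 : ℝ) 2 (A₀ + s • B))
    {k : ℕ} (hk1 : 1 ≤ k) (hkN : k ≤ N + 1) (p : quadIndex d) :
    (L : ℝ) ^ ((k - 1) * d) *
        |gradCov (𝒞 (A₀ + (2 * t) • B) k) p - 2 * gradCov (𝒞 (A₀ + t • B) k) p + gradCov (𝒞 A₀ k) p| ≤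
      secondDiffConst (fun α => Cα α 2) * t ^ 2 := by
  have hL0 : (0 : ℝ) < L := by exact_mod_cast (show 0 < L by omega)
  have hLpow : 0 < (L : ℝ) ^ ((k - 1) * d) := pow_pos hL0 _
  set θ : Fin d → ℕ := Pi.single p.1.2 1 + Pi.single p.1.1 1 with hθ
  set x₀ : Fin d → ZMod M := -(Pi.single p.1.2 1 : Fin d → ZMod M) with hx₀
  have hθ2 : ∑ i, θ i = 2 := by
    rw [hθ]; simp [Finset.sum_add_distrib, Pi.single_apply]
  have hgrad : ∀ 𝒦 : (Fin d → ZMod M) → ℝ, gradCov 𝒦 p = -iterDiff θ 𝒦 x₀ :=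
    fun 𝒦 => gradCov_eq_neg_iterDiff 𝒦 p
  have hexp : (k - 1) * (d - 2 + ∑ i, θ i) = (k - 1) * d := by rw [hθ2, Nat.sub_add_cancel hd]
  have hsmooth : ∀ u ∈ Icc 0 (2 * t), ∃ ε : ℝ, 0 < ε ∧ ∀ y,
      ContDiffOn ℝ ⊤ (fun s : ℝ => (fun A => 𝒞 A k) (A₀ + u • B + s • B) y) (Ioo (-ε) ε) :=
    fun u hu => (hiv _ (hell u hu) k hk1 hkN B hBu).1
  have hbound : ∀ u ∈ Icc 0 (2 * t),
      |iteratedDeriv 2 (fun s : ℝ => iterDiff θ ((fun A => 𝒞 A k) (A₀ + u • B + s • B)) x₀) 0| ≤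
        Cα θ 2 / (L : ℝ) ^ ((k - 1) * d) := by
    intro u hu
    have h := (hiv _ (hell u hu) k hk1 hkN B hBu).2 θ (by omega) 2 x₀
    rw [hexp] at h
    exact h
  have hmv := abs_iterDiff_segment_secondDiff_le (𝒦 := fun A => 𝒞 A k) (A₀ := A₀) ht θ x₀ hsmooth hbound
  have hC : Cα θ 2 ≤ secondDiffConst fun α => Cα α 2 := le_secondDiffConst (fun α => Cα α 2) hθ2
  rw [hgrad, hgrad, hgrad, show -iterDiff θ (𝒞 (A₀ + (2 * t) • B) k) x₀ - 2 * -iterDiff θ (𝒞 (A₀ + t • B) k) x₀ +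
      -iterDiff θ (𝒞 A₀ k) x₀ = -(iterDiff θ (𝒞 (A₀ + (2 * t) • B) k) x₀ - 2 * iterDiff θ (𝒞 (A₀ + t • B) k) x₀ +
        iterDiff θ (𝒞 A₀ k) x₀) by ring, abs_neg]
  calc (L : ℝ) ^ ((k - 1) * d) *
        |iterDiff θ (𝒞 (A₀ + (2 * t) • B) k) x₀ - 2 * iterDiff θ (𝒞 (A₀ + t • B) k) x₀ + iterDiff θ (𝒞 A₀ k) x₀|
      ≤ (L : ℝ) ^ ((k - 1) * d) * (Cα θ 2 / (L : ℝ) ^ ((k - 1) * d) * t ^ 2) :=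
        mul_le_mul_of_nonneg_left hmv hLpow.le
    _ = Cα θ 2 * t ^ 2 := by field_simp
    _ ≤ secondDiffConst (fun α => Cα α 2) * t ^ 2 := mul_le_mul_of_nonneg_right hC (sq_nonneg _)

end Literature.MathematicalPhysics.StatisticalMechanics.GradientRG

end
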